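import Summits.QuantumFields.QCD.Theses.SeaNonGibbs
import HarnessLib.Audit

/-!
# Birth skeleton (BC3) for the crux `SeaThreshold` (item stmt-QuantumFields-17629)

Route `SeaNonGibbs` (sub-problem QCD), crux decl
`Summit.QuantumFields.QCD.Theses.SeaNonGibbs.SeaThreshold` (rev 7; the flagged ENGINE item, rank 6):

  `QuasilocalAfterBlocking → ∀ N_f ∈ {2,3}, ∃ M₀ ≥ 0, ∃ reg, reg.HasMassScaling ∧ ∀ m > M₀,
     ∃ z shift T, IsQCDAlong (reg.scheme m z shift) T ∧ T.IsNontrivial glue ∧ T.IsNonGaussian glue ∧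
       (∀ f ≠ g, T.IsNontrivial (pseudoRe f g)) ∧ ∃ Δ > 0, T.HasMassGap Δ ∧ (reg.scheme m z shift).HasLatticeMassGap Δ`

(after the arrow: the body of `HeavyThresholdYMBridge.ThresholdQCD`, stmt-QuantumFields-8794, verbatim).

Registered by the skeleton-registrar seat `planner-skel-stmt-QuantumFields-17629-0` (route re-audit bin REPAIRABLE,
2026-08-17) as `Cruxes/SeaThreshold/Lines/birth.lean`.  It is the route-level BIRTH CERTIFICATE of the crux (≥ 2 named
stubs, a kernel-checked composition concluding the crux BY NAME, `sorry` only inside `stub_*`), cut along the route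
header's OWN two-layer plan for this node —
`SeaThreshold ⇐ DefectRobustYM → SeaAdmissible → FermionicInheritance` ("quark channels, IsQCDAlong clauses,
non-decoupling"), the engine being "lattice gap + sequential OS limit" of a defect-robust SU(3) Yang–Mills engine
FED WITH THE BLOCKED SEA — into one ENGINE piece carrying the route's input and two INHERITANCE laws, all typed over
the Statement's own vocabulary (`IsQCDAlong`, `HasMassScaling`, `HasLatticeMassGap`, `HasMassGap`, `IsNontrivial`,
`IsNonGaussian`, `QCDLatticeObservable`, `qcdLatticeConnectedCorr`):

* `stub_blockedSeaEngine : Stmt.stub_blockedSeaEngine` (open-problem; DefectRobustYM ∘ SeaAdmissible with the species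
  limits) — `QuasilocalAfterBlocking →` for `N_f ∈ {2,3}`: an offset `M₀ ≥ 0` and ONE mass-independent
  regularisation with `HasMassScaling` carrying, for EVERY tuple `m > M₀`, (i) OS data `T` with `IsQCDAlong`,
  non-trivial non-Gaussian glue and non-decoupled flavour-changing pseudoscalars (the sequential OS limit of the
  engine, all species), and (ii) the GAUGE-SECTOR lattice gap `GaugeSectorLatticeGap (reg.scheme m 0 0) Δ₀`,
  `Δ₀ = Δ₀(m) > 0`: volume-uniform exponential clustering, in physical units, of every pair of purely GLUONIC
  gauge-invariant local lattice observables (Wilson loops …) under the UNQUENCHED lattice QCD measure — exactly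
  what a Yang–Mills engine acting on the (blocked) gauge marginal delivers.  No quark-channel lattice gap, no
  continuum gap.  It is the only stub that reads the route's input `QuasilocalAfterBlocking`.
* `stub_fermionicInheritance : Stmt.stub_fermionicInheritance` (size L / open; the header's node FermionicInheritance at
  the lattice level, a ∀-law over regularisations) — for `N_f ∈ {2,3}`, EVERY regularisation with
  `HasMassScaling` that carries dynamical-quark continuum data above some `M₀ ≥ 0` AND the gauge-sector lattice
  gap at every tuple above `M₀` has a possibly LARGER threshold `M₁ ≥ M₀` above which every tuple has the FULL
  lattice gap `(reg.scheme m 0 0).HasLatticeMassGap Δ`, `Δ = Δ(m) > 0` (all gauge-invariant local observables: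
  mesons, baryons, … inherit the clustering of the glue at heavy renormalised quark mass).  The freedom
  `M₁ ≥ M₀` is what makes the law honest (no claim about light flavoured channels near the offset).
* `stub_gapInheritance : Stmt.stub_gapInheritance` (size M/L; "clustering ⇒ spectral gap through OS reconstruction",
  route-independent; its body is verbatim that of `GapInheritanceStmt` in the sibling skeleton
  `Cruxes/MassiveBridge/Lines/birth.lean`, so one proof serves both registrations) — for every scheme `sch`, OS
  data `T` and `Δ > 0`:
  `IsQCDAlong sch T` and `sch.HasLatticeMassGap Δ` give some `Δ' ∈ (0, Δ]` with `T.HasMassGap Δ'`.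

`SeaThreshold_of : Stmt.stub_blockedSeaEngine → Stmt.stub_fermionicInheritance → Stmt.stub_gapInheritance → SeaThreshold` is
kernel-checked: the engine stub, fed with the route input, yields `(M₀, reg, data, gauge-sector gap)`; the
fermionic inheritance law, fed with the data's dynamical part and the gauge-sector gap, yields `M₁ ≥ M₀` and the
full lattice gap above it; for a tuple above `M₁` the data give `(z, shift, T)`, the lattice gap `Δ` is moved to the
data's own scheme `reg.scheme m z shift` (the lattice clause reads only `β_k, m_f(k), L_k, a_k` —
`hasLatticeMassGap_scheme_iff`, by `Iff.rfl`), the OS-reconstruction law gives `Δ' ≤ Δ` with `T.HasMassGap Δ'`, and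
the lattice gap is weakened to the common rate `Δ'` (`hasLatticeMassGap_mono`, proved here).  The threshold of the
crux is `M₁` (`0 ≤ M₀ ≤ M₁`).  `seaThreshold_of_stubs : SeaThreshold` instantiates it.

## Negative knowledge honoured (read 2026-08-17)
* `Cruxes/SeaThreshold/` had NO workfiles before this one (no `Disproof.lean`, no ideas, no dead lines); the
  crux's only notes are the grounder's (g70-9: open problem, QCD-complete, consequent = ThresholdQCD body).
* `ledger negatives --problem QuantumFields` (5 entries: RobustYangMillsRG stmt-14958 — a wild blocking map
  inhabits an under-constrained admissibility predicate; MirrorModularBoosts stmt-9665; AdaptiveCoarseSystem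
  stmt-9494; MultibosonLatticeGap stmt-9599 — an unsatisfiable admissibility clause; AdmissibleRootsExist
  stmt-9603).  Lesson applied: NO bespoke admissibility predicate for the "defect-robust engine" is introduced —
  the engine is recorded only through its OUTPUT in the Statement's vocabulary; the one new predicate,
  `GaugeSectorLatticeGap`, is the Statement's own `HasLatticeMassGap` clause RESTRICTED to gluonic pairs
  (`gaugeSectorLatticeGap_of_hasLatticeMassGap`, proved), so it is inhabited whenever the crux's conclusion is.
* Junk witnesses: the vacuum data with `z ≡ 0` inhabit `IsQCDAlong` (`isQCDAlong_zeroAF_vacuum`) but NOT the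
  non-decoupling clause, so the data hypothesis of the fermionic law is not junk-inhabited; in the OS-reconstruction
  law the vacuum satisfies the conclusion (`OSData.vacuum_hasMassGap`).  Where the fermionic partition function
  vanishes (signed `N_f = 3` weight) `qcdTorusExpect` is junk `0` on BOTH sides of the fermionic law.
* Typing checklist 4c: no Bochner integral over a free function is introduced, no hand-picked threshold or rate
  (`M₀, M₁, Δ₀, Δ, Δ'` existential), no determinantal / complex-action positivity claim.

## BC3 probes (planner folder `bc/`): for each stub statement `S`, `S → SeaThreshold` and `S → QCD` by
`first | exact? | simpa | aesop` FAIL (files `bc/probe_<stub>.lean`, statements copied verbatim with no stub or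
composition in scope; rc and goals in the seat's NOTES.md and in `Lines/birth.md`).
-/

noncomputable section

namespace Summit.QuantumFields.QCD.Cruxes.SeaThreshold.Birth

open scoped BigOperators Topology Classical
open MeasureTheory Filter
open Literature.Probability.LatticeModels Literature.MathematicalPhysics.QuantumLattice
open Literature.MathematicalPhysics.QuantumFieldTheory
open Summit.QuantumFields.QCD.Theses.SeaNonGibbs

/-! ## §0 Currency (the Statement's vocabulary only) -/

/-- **Dynamical-quark continuum data of `reg` above the flavour-blind threshold `M₀`**: for every tuple `m` with
all `m_f > M₀` there are species renormalisations `z, shift` and OS data `T` with `IsQCDAlong (reg.scheme m z shift) T`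
whose flavour-CHANGING pseudoscalars `Re ψ̄_f iγ₅ ψ_g`, `f ≠ g`, are not c-numbers (quarks propagate). -/
def DynamicalDataAbove (Nf : ℕ) (reg : QCDRegularisation Nf) (M₀ : ℝ) : Prop :=
  ∀ m : Fin Nf → ℝ, (∀ f, M₀ < m f) →
    ∃ (z shift : QCDField Nf → ℕ → ℝ) (T : OSData (QCDField Nf) 4),
      IsQCDAlong (reg.scheme m z shift) T ∧
        ∀ f g : Fin Nf, f ≠ g → T.IsNontrivial (QCDField.pseudoRe f g)

/-- **Full continuum data of `reg` above `M₀`**: as `DynamicalDataAbove`, with non-trivial and non-Gaussian glue —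
verbatim the body of the crux's consequent with its gap clause deleted. -/
def ContinuumDataAbove (Nf : ℕ) (reg : QCDRegularisation Nf) (M₀ : ℝ) : Prop :=
  ∀ m : Fin Nf → ℝ, (∀ f, M₀ < m f) →
    ∃ (z shift : QCDField Nf → ℕ → ℝ) (T : OSData (QCDField Nf) 4),
      IsQCDAlong (reg.scheme m z shift) T ∧ T.IsNontrivial QCDField.glue ∧
        T.IsNonGaussian QCDField.glue ∧
          ∀ f g : Fin Nf, f ≠ g → T.IsNontrivial (QCDField.pseudoRe f g)

/-- Full continuum data contain the dynamical-quark data. [folklore] -/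
theorem ContinuumDataAbove.dynamical {Nf : ℕ} {reg : QCDRegularisation Nf} {M₀ : ℝ}
    (h : ContinuumDataAbove Nf reg M₀) : DynamicalDataAbove Nf reg M₀ := by
  intro m hm
  obtain ⟨z, shift, T, hqcd, -, -, hps⟩ := h m hm
  exact ⟨z, shift, T, hqcd, hps⟩

/-- **A purely GLUONIC gauge-invariant local lattice observable**: its Grassmann value is a scalar (no quark
content) for every gauge field — Wilson loops, plaquette polynomials, …; the gauge-invariance, cylinder and
boundedness clauses of `QCDLatticeObservable` then make `g` a bounded gauge-invariant cylinder function of the links. -/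
def IsGluonic {Nf R : ℕ} (A : QCDLatticeObservable Nf R) : Prop :=
  ∃ g : LGConfig 4 (Matrix.specialUnitaryGroup (Fin 3) ℂ) → ℂ, ∀ U, A.F U = algebraMap ℂ (BoxFermiAlg Nf R) (g U)

/-- **Gauge-sector lattice gap `Δ` of the UNQUENCHED lattice theory along `sch`** — the Statement's
`QCDScheme.HasLatticeMassGap` clause restricted to pairs of gluonic observables: for all gluonic `A, B` there is `C`
with `‖⟨A · τ_{n e₀}B⟩_{k,S} − ⟨A⟩_{k,S}⟨B⟩_{k,S}‖ ≤ C e^{−Δ a_k n}` for all large `k`, every torus `2S+1 ≥ 2L_k+1` and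
all `n ≤ S`, the expectations being those of lattice QCD WITH its (signed) fermion determinant at `β_k`, `m_f(k)`.
This is the natural output of a Yang–Mills engine run on the fermion-integrated gauge marginal. -/
def GaugeSectorLatticeGap {Nf : ℕ} (sch : QCDScheme Nf) (Δ : ℝ) : Prop :=
  ∀ (R R' : ℕ) (A : QCDLatticeObservable Nf R) (B : QCDLatticeObservable Nf R'),
    IsGluonic A → IsGluonic B → ∃ C : ℝ,
      ∀ᶠ k in atTop, ∀ S : ℕ, sch.L k ≤ S → ∀ n : ℕ, n ≤ S →
        ‖qcdLatticeConnectedCorr (sch.β k) (2 * S + 1) (fun fl => sch.mq fl k) A B n‖ ≤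
          C * Real.exp (-(Δ * (sch.a k * n)))

/-- The full lattice gap contains the gauge-sector lattice gap (restriction to gluonic pairs): the engine's
output (ii) is implied by the crux's conclusion, so the cut loses nothing. [folklore] -/
theorem gaugeSectorLatticeGap_of_hasLatticeMassGap {Nf : ℕ} (sch : QCDScheme Nf) {Δ : ℝ}
    (h : sch.HasLatticeMassGap Δ) : GaugeSectorLatticeGap sch Δ :=
  fun R R' A B _ _ => h R R' A B

/-! ## §1 The three stub statements

Naming (for `ledger skeleton check` / `#h21_check_skeleton`): the statement of the registered stub `stub_<name>` is the
`def Stmt.stub_<name> : Prop` below, so that every hypothesis of the composition `SeaThreshold_of` is headed by a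
constant whose short name IS a declared stub ("hypotheses must be exactly registered obligations / declared stubs, each
by name") — crux workfiles may not carry the gate-reserved `@[stub]` tag, and an inline signature has no head constant.
The prose names (S1) BlockedSeaEngine / (S2) FermionicInheritance / (S3) GapInheritance are used in the docstrings. -/

/-- **(S1) The defect-robust Yang–Mills engine fed with the blocked Wilson sea** (the route's nodes
DefectRobustYM ∘ SeaAdmissible, with the species limits; open-problem, QCD-complete).  FROM `QuasilocalAfterBlocking`
— one axial block step turns every infinite-volume sea state of `qcdLatticeMeasure` at `β ≥ 0`, `m ∈ (−2,0)` into a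
Gibbs measure for a quasilocal specification (a quasilocal block potential that is NOT sup-small near mode-pinning
block patterns: a dilute, for odd `N_f` signed, defect layer inside Bałaban's small-field region) — a DEFECT-ROBUST
`SU(3)` Yang–Mills engine (lattice gap + sequential OS limit stable under perturbations analytic and small on
small-field block configurations except on defects of small activity; card K3 RobustnessWithDefects), run on the
blocked sea along an asymptotically scaling sequence with bare masses on the line of constant physics
`m_f(k) = m_crit(k) + a_k m_f/Z_m(k)`, delivers for `N_f = 2, 3`: an offset `M₀ ≥ 0`, ONE mass-independent
regularisation with `HasMassScaling`, and for EVERY tuple above `M₀` (i) OS data of all species tied to lattice QCD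
along the sequence with non-trivial non-Gaussian glue and non-decoupled flavour-changing pseudoscalars, (ii) the
gauge-sector lattice gap of the unquenched theory, uniformly in the volume.  NO quark-channel lattice gap and NO
continuum gap are claimed.  Why it might fail: QCD-complete — (c) is qualitative (fixed `β, m`; no rate, no
uniformity along `β_k → ∞` / the LCP), no defect-robust SU(3) YM engine exists even for `N_f = 0`, `m_crit(k)` must be
tuned INSIDE the non-quasilocal window `κ > 1/8`, odd-`N_f` signed defect activities, fermionic species limits;
vacuously true if (c) is refuted.  Size: open-problem. -/
def Stmt.stub_blockedSeaEngine : Prop :=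
  QuasilocalAfterBlocking → ∀ Nf : ℕ, Nf = 2 ∨ Nf = 3 → ∃ M₀ : ℝ, 0 ≤ M₀ ∧ ∃ reg : QCDRegularisation Nf,
    reg.HasMassScaling ∧ ContinuumDataAbove Nf reg M₀ ∧
      ∀ m : Fin Nf → ℝ, (∀ f, M₀ < m f) → ∃ Δ₀ : ℝ, 0 < Δ₀ ∧ GaugeSectorLatticeGap (reg.scheme m 0 0) Δ₀

/-- **(S2) Fermionic inheritance of the lattice gap** (the route's node FermionicInheritance at the lattice
level; size L / open).  For `N_f ∈ {2,3}`, EVERY regularisation `reg` with `HasMassScaling` carrying dynamical-quark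
continuum data above some `M₀ ≥ 0` (which pins `m_crit(k)` to a bounded, convergent renormalised offset of the honest
critical line: full-sequence convergence forbids an oscillating `m_crit`, non-decoupling a runaway one) AND the
gauge-sector lattice gap at every tuple above `M₀` admits a threshold `M₁ ≥ M₀` such that every tuple with all
`m_f > M₁` has the FULL uniform lattice gap `(reg.scheme m 0 0).HasLatticeMassGap Δ`, `Δ = Δ(m) > 0` (ALL pairs of
gauge-invariant local lattice QCD observables — mesons, baryons, point-split hadrons — on every torus `2S+1 ≥ 2L_k+1`,
uniformly in `S`; the clause reads only `β_k, m_f(k), L_k, a_k`, whence `z = shift = 0`).  Why plausibly true: above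
`M₁ = M₀ + |d| + M_heavy` the renormalised quarks are heavy against the glue scale, the fermion-integrated form of a
quark-carrying correlator is a finite sum of quark-line terms decaying at the heavy rate `≍ 2M a_k n` times bounded
gluonic functionals plus quark-loop × quark-loop terms, which are (exponentially localised) gluonic observables and
cluster at the gauge-sector rate — so every channel inherits `min(Δ₀, heavy rate) > 0`.  Why it might fail (as typed):
the gauge-sector clause gives constants PER PAIR of strictly local observables, with no uniformity over the growing
supports needed to approximate the exponentially localised quark loops; the scheme's functional is the finite-torus
`(−1)^F`-twisted trace with a SIGNED `N_f = 3` weight (junk `0` where the partition function vanishes, on both sides);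
random-walk bounds on heavy Wilson quark lines must hold uniformly in `U` near `m_f(k) ≈ m_crit(k) < 0`, inside this
route's non-quasilocal window.  Size: L / open. -/
def Stmt.stub_fermionicInheritance : Prop :=
  ∀ Nf : ℕ, Nf = 2 ∨ Nf = 3 → ∀ (reg : QCDRegularisation Nf) (M₀ : ℝ), reg.HasMassScaling → 0 ≤ M₀ →
    DynamicalDataAbove Nf reg M₀ →
      (∀ m : Fin Nf → ℝ, (∀ f, M₀ < m f) → ∃ Δ₀ : ℝ, 0 < Δ₀ ∧ GaugeSectorLatticeGap (reg.scheme m 0 0) Δ₀) →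
        ∃ M₁ : ℝ, M₀ ≤ M₁ ∧ ∀ m : Fin Nf → ℝ, (∀ f, M₁ < m f) →
          ∃ Δ : ℝ, 0 < Δ ∧ (reg.scheme m 0 0).HasLatticeMassGap Δ

/-- **(S3) Continuum gap inheritance through OS reconstruction** (size M/L; route-independent — stated verbatim
as `GapInheritanceStmt` in `Cruxes/MassiveBridge/Lines/birth.lean`, so the two skeletons share it by normalised signature).
For every scheme `sch`, OS data `T` and rate `Δ > 0`: if `T` is QCD along `sch` (all lattice `n`-point functions of the
species fields converge to `T`'s Schwinger functions on off-diagonal real tensors) and the lattice theories of `sch`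
have the uniform full-spectrum lattice gap `Δ`, then `T` has a mass gap `Δ'` for some `0 < Δ' ≤ Δ` (`T.HasMassGap Δ'`:
uniform exponential clustering of ALL truncated Schwinger functions, `σ(H) ⊆ {0} ∪ [Δ', ∞)` on the full OS space of
`T`).  Why plausibly true: the smeared species fields are finite sums of translates of local lattice observables, so
their connected Euclidean-time correlations inherit the lattice decay in physical units; the bound passes to the
`k → ∞` limits on off-diagonal real tensors, a total set for the OS reconstruction of `T`; a Laplace-transform
argument on spectral measures upgrades clustering on a total set to the spectral gap (Glimm–Jaffe Thm 6.1.3, §19).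
Why it might fail (as typed): the constants of `HasLatticeMassGap` are per pair, not uniform over the `O(a_k⁻⁴)`
translates entering a smeared field; the finite-torus functional is the `(−1)^F`-twisted trace — the honest route is
the transfer-matrix spectral bound at each `k` plus `a_k L_k → ∞`.  Size: M/L. -/
def Stmt.stub_gapInheritance : Prop :=
  ∀ (Nf : ℕ) (sch : QCDScheme Nf) (T : OSData (QCDField Nf) 4) (Δ : ℝ),
    IsQCDAlong sch T → 0 < Δ → sch.HasLatticeMassGap Δ →
      ∃ Δ' : ℝ, 0 < Δ' ∧ Δ' ≤ Δ ∧ T.HasMassGap Δ'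

/-! ## §2 The registered stubs (the ONLY `sorry`s of this file) -/

/-- (S1) the defect-robust YM engine fed with the blocked sea — open-problem (QCD-complete). -/
theorem stub_blockedSeaEngine : Stmt.stub_blockedSeaEngine := by
  sorry

/-- (S2) fermionic inheritance of the lattice gap — size L / open. -/
theorem stub_fermionicInheritance : Stmt.stub_fermionicInheritance := by
  sorry

/-- (S3) continuum gap inheritance through OS reconstruction — size M/L. -/
theorem stub_gapInheritance : Stmt.stub_gapInheritance := by
  sorry

/-! ## §3 Composition (kernel-checked; no `sorry` below this line) -/

/-- The lattice gap clause of a regularisation's scheme does not read the species renormalisations `z, shift`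
(only `β_k, m_f(k), L_k, a_k`): definitional. [folklore] -/
theorem hasLatticeMassGap_scheme_iff {Nf : ℕ} (reg : QCDRegularisation Nf) (m : Fin Nf → ℝ)
    (z shift : QCDField Nf → ℕ → ℝ) (Δ : ℝ) :
    (reg.scheme m z shift).HasLatticeMassGap Δ ↔ (reg.scheme m 0 0).HasLatticeMassGap Δ :=
  Iff.rfl

/-- **Monotonicity of the uniform lattice gap in the rate**: a lattice gap `Δ` is a lattice gap `Δ' ≤ Δ`
(the constant is replaced by `max C 0`; `a_k n ≥ 0`). [folklore] -/
theorem hasLatticeMassGap_mono {Nf : ℕ} (sch : QCDScheme Nf) {Δ Δ' : ℝ}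
    (h : sch.HasLatticeMassGap Δ) (hle : Δ' ≤ Δ) : sch.HasLatticeMassGap Δ' := by
  intro R R' A B
  obtain ⟨C, hC⟩ := h R R' A B
  refine ⟨max C 0, ?_⟩
  filter_upwards [hC] with k hk S hS n hn
  have h1 := hk S hS n hn
  have han : 0 ≤ sch.a k * (n : ℝ) := mul_nonneg (sch.a_pos k).le (Nat.cast_nonneg n)
  have hexp : Real.exp (-(Δ * (sch.a k * n))) ≤ Real.exp (-(Δ' * (sch.a k * n))) :=
    Real.exp_le_exp.2 (by nlinarith)
  exact h1.trans ((mul_le_mul_of_nonneg_right (le_max_left C 0) (Real.exp_pos _).le).trans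
    (mul_le_mul_of_nonneg_left hexp (le_max_right C 0)))

/-- **The crux from the three stubs** (concludes `SeaThreshold` BY NAME).  The engine stub, fed with the route input
`QuasilocalAfterBlocking`, gives the offset `M₀`, the regularisation, its continuum data and its gauge-sector lattice
gap; the fermionic inheritance law, fed with the dynamical part of the data and the gauge-sector gap, gives the
working threshold `M₁ ≥ M₀` and the full lattice gap above it; above `M₁` the data supply `(z, shift, T)`, the
lattice law a rate `Δ`, moved to the data's own scheme by `hasLatticeMassGap_scheme_iff`; the OS-reconstruction law a
continuum rate `Δ' ≤ Δ`; and the lattice gap is weakened to the common rate `Δ'` by `hasLatticeMassGap_mono`. -/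
theorem SeaThreshold_of :
    Stmt.stub_blockedSeaEngine → Stmt.stub_fermionicInheritance → Stmt.stub_gapInheritance → SeaThreshold := by
  intro hE hF hT
  unfold SeaThreshold
  intro hQ Nf hNf
  obtain ⟨M₀, hM₀, reg, hms, hdata, hgauge⟩ := hE hQ Nf hNf
  obtain ⟨M₁, hM₀₁, hgap⟩ := hF Nf hNf reg M₀ hms hM₀ hdata.dynamical hgauge
  refine ⟨M₁, hM₀.trans hM₀₁, reg, hms, fun m hm => ?_⟩
  have hm₀ : ∀ f, M₀ < m f := fun f => hM₀₁.trans_lt (hm f)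
  obtain ⟨z, shift, T, hqcd, hglue, hng, hps⟩ := hdata m hm₀
  obtain ⟨Δ, hΔ, hlat⟩ := hgap m hm
  have hlat' : (reg.scheme m z shift).HasLatticeMassGap Δ :=
    (hasLatticeMassGap_scheme_iff reg m z shift Δ).2 hlat
  obtain ⟨Δ', hΔ', hle, hTgap⟩ := hT Nf (reg.scheme m z shift) T Δ hqcd hΔ hlat'
  exact ⟨z, shift, T, hqcd, hglue, hng, hps, Δ', hΔ', hTgap, hasLatticeMassGap_mono _ hlat' hle⟩

/-- The crux along this skeleton, from the registered stubs (sorries only inside `stub_*`). -/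
theorem seaThreshold_of_stubs : SeaThreshold :=
  SeaThreshold_of stub_blockedSeaEngine stub_fermionicInheritance stub_gapInheritance

end Summit.QuantumFields.QCD.Cruxes.SeaThreshold.Birth

end
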